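import Summits.AtomisticToContinuum.Crystallization.Theses.BraggSlacknessRigidity
import Summits.AtomisticToContinuum.Crystallization.Theorems.ThreeConeCertificateExactCertificateFieldNear

/-!
# Crux `StrictCertificate` (stmt-AtomisticToContinuum-13167, route `BraggSlacknessRigidity`):
# necessary conditions on a witness, IV — EINSTEIN DOMINATION of the Bochner kernel

Support file for the line `registered` (lead c4); nothing here closes the item.  Let
`⟨P, ρ, c, g, U, f⟩` be a witness of the crux — more generally any three-cone split
`IsSplit ρ c g U f` of `V = V_LJ` attaining a periodic configuration `P` (`c + f 0/2 ≤ −e_V(P)`),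
so everything below is also a necessary condition for the sibling crux `ExactCertificate` (11959).
Fix a site `p₀ ∈ P` and a probe `w ∉ P` (think `w = p₀ + u`: the site DISPLACED by `u`).  Then

* `f_dist_probe_eq` / `f_zero_eq_neg_tsum` — by THE INVISIBILITY THEOREM
  (`Field.invisible_of_isSplit`: `Σ_{y ∈ P} f(dist w y) = 0` at every `w ∈ ℝ³`) read at the probe
  `w` and at the site `p₀`:  `f(dist w p₀) = −Σ'_{y ≠ p₀} f(dist w y)` and
  `f 0 = −Σ'_{y ≠ p₀} f(dist p₀ y)`;
* termwise `f = V − g − U ≤ V − g` at the (positive) distances from the probe, and `f = V − g`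
  EXACTLY at the distances from the site (complementary slackness `U = 0` on `D_P`,
  `Slackness.U_site_eq_zero`);
* hence **EINSTEIN DOMINATION** (`f_zero_sub_f_le_cavity`):
  `f 0 − f(dist w p₀) ≤ Σ'_{y ∈ P, y ≠ p₀} [(V − g)(dist w y) − (V − g)(dist p₀ y)]`
  — the drop of the Bochner kernel below its maximum `f 0` over the displacement `p₀ ↦ w` is paid by
  the CAVITY EXCESS of the remainder `V − g`: the change of the `(V − g)`-energy of the crystal when
  the single particle at `p₀` is moved to `w`, all others fixed (an Einstein-oscillator energy).
  Both cavity families are absolutely summable (`summable_cavity_probe`, `summable_cavity_site`).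
* `einstein_of_clauses` — the same with the crux's conjuncts 2–7 verbatim as hypotheses.

Why it matters (README for the disprover).  With the single-site stability of the finite-range cone
(`ΔE_g(u) ≥ 0`, next file) the `g`-terms drop out and `0 ≤ f 0 − f ‖u‖ ≤ ΔE_V(u) = O(‖u‖²)`: the
kernel of every exact certificate is `C^{1,1}`-flat at the origin, its Fourier transform has a FINITE
SECOND MOMENT bounded by the Einstein trace `Σ ΔṼ` of the template, `F = f∘‖·‖ ∈ C²(ℝ³)`, and the
contact `f ≤ V` is tangential at every shell — regularity that any non-interpolation (W1) argument
may now assume.  All `[folklore]` (Cohn–Kumar-type complementary slackness, read at a displaced site).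
-/

noncomputable section

namespace Summit.AtomisticToContinuum.Crystallization.Theorems.BraggSlacknessRigidityStrictCertificate

open Literature.MathematicalPhysics.StatisticalMechanics
open Summit.AtomisticToContinuum.Crystallization.Theorems.ExactCertificateNegative (IsSplit)
open Summit.AtomisticToContinuum.Crystallization.Theorems.ChargedEnergyGapNegative (E3)
open Summit.AtomisticToContinuum.Crystallization.Theorems.ThreeConeCertificateExactCertificate.Slackness
  (U_site_eq_zero summable_of_finRange summable_f_site)
open Summit.AtomisticToContinuum.Crystallization.Theorems.ThreeConeCertificateExactCertificate.Field
  (invisible_of_isSplit siteSum_eq_neg_f_zero_of_isSplit)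
open scoped BigOperators

/-! ## Summability of the cavity families -/

/-- The points of `P` other than the site `p₀` embed into the points of `P` other than a probe
`w ∉ P`. [folklore] -/
theorem injective_siteToProbe (P : PeriodicConfiguration 3) {p₀ w : E3} (hw : w ∉ P.points) :
    Function.Injective fun q : {q : E3 // q ∈ P.points ∧ q ≠ p₀} =>
      (⟨q.1, q.2.1, fun h => hw (h ▸ q.2.1)⟩ : {q : E3 // q ∈ P.points ∧ q ≠ w}) := by
  intro q q' h
  have h1 := congrArg Subtype.val h
  exact Subtype.ext h1

/-- **The Lennard-Jones field of the cavity `P ∖ {p₀}` is absolutely summable at every probe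
`w ∉ P`.** [folklore] -/
theorem summable_lennardJones_probe (P : PeriodicConfiguration 3) {p₀ w : E3} (hw : w ∉ P.points) :
    Summable fun q : {q : E3 // q ∈ P.points ∧ q ≠ p₀} => lennardJones (dist w q.1) := by
  have hi := injective_siteToProbe P (p₀ := p₀) hw
  have h2 := (P.summable_lennardJones_dist_three w).comp_injective hi
  exact h2

/-- A finite-range site function of the cavity is summable at every probe `w ∉ P`. [folklore] -/
theorem summable_finRange_probe (P : PeriodicConfiguration 3) {W : ℝ → ℝ} {ρ : ℝ}
    (hW : ∀ r, ρ ≤ r → W r = 0) {p₀ w : E3} (hw : w ∉ P.points) :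
    Summable fun q : {q : E3 // q ∈ P.points ∧ q ≠ p₀} => W (dist w q.1) := by
  have hi := injective_siteToProbe P (p₀ := p₀) hw
  have h2 := (summable_of_finRange P hW w).comp_injective hi
  exact h2

/-- **The `(V − g)`-field of the cavity is summable at the probe.** [folklore] -/
theorem summable_cavity_probe (P : PeriodicConfiguration 3) {ρ c : ℝ} {g U f : ℝ → ℝ}
    (h : IsSplit ρ c g U f) {p₀ w : E3} (hw : w ∉ P.points) :
    Summable fun q : {q : E3 // q ∈ P.points ∧ q ≠ p₀} =>
      lennardJones (dist w q.1) - g (dist w q.1) :=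
  (summable_lennardJones_probe P hw).sub (summable_finRange_probe P h.g_zero hw)

/-- **The `(V − g)`-site sum of the cavity at its own site is summable.** [folklore] -/
theorem summable_cavity_site (P : PeriodicConfiguration 3) {ρ c : ℝ} {g U f : ℝ → ℝ}
    (h : IsSplit ρ c g U f) (p₀ : E3) :
    Summable fun q : {q : E3 // q ∈ P.points ∧ q ≠ p₀} =>
      lennardJones (dist p₀ q.1) - g (dist p₀ q.1) :=
  (P.summable_lennardJones_dist_three p₀).sub (summable_of_finRange P h.g_zero p₀)

/-! ## Invisibility read at the probe and at the site -/

/-- **Invisibility at the probe, with the site term split off**: for a witness, `p₀ ∈ P` and a probe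
`w ∉ P`, the `f`-field of the cavity `P ∖ {p₀}` at `w` is summable and
`f(dist w p₀) + Σ'_{y ∈ P, y ≠ p₀} f(dist w y) = 0`. [folklore] -/
theorem f_dist_probe_add_tsum_eq_zero {P : PeriodicConfiguration 3} {ρ c : ℝ} {g U f : ℝ → ℝ}
    (h : IsSplit ρ c g U f) (hv : c + f 0 / 2 ≤ -(P.energyPerParticle lennardJones))
    {p₀ w : E3} (hp₀ : p₀ ∈ P.points) :
    (Summable fun q : {q : E3 // q ∈ P.points ∧ q ≠ p₀} => f (dist w q.1)) ∧
    f (dist w p₀) + ∑' q : {q : E3 // q ∈ P.points ∧ q ≠ p₀}, f (dist w q.1) = 0 := by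
  have hinv := invisible_of_isSplit h hv w
  set s : Finset P.points := {⟨p₀, hp₀⟩} with hs
  have hsplit := hinv.summable.sum_add_tsum_subtype_compl s
  rw [hinv.tsum_eq, hs, Finset.sum_singleton] at hsplit
  -- summability over the cavity: a sub-family of the field
  have hi : Function.Injective fun q : {q : E3 // q ∈ P.points ∧ q ≠ p₀} =>
      (⟨q.1, q.2.1⟩ : P.points) := by
    intro q q' hqq'
    have h1 := congrArg Subtype.val hqq'
    exact Subtype.ext h1
  have hsum0 := hinv.summable.comp_injective hi
  have hsum : Summable fun q : {q : E3 // q ∈ P.points ∧ q ≠ p₀} => f (dist w q.1) := hsum0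
  refine ⟨hsum, ?_⟩
  -- the cavity and the complement of the site in `P.points`
  let e : {y : P.points // y ∉ ({⟨p₀, hp₀⟩} : Finset P.points)} ≃
      {q : E3 // q ∈ P.points ∧ q ≠ p₀} :=
    { toFun := fun y => ⟨(y.1 : E3), y.1.2, fun heq =>
          y.2 (Finset.mem_singleton.2 (Subtype.ext heq))⟩
      invFun := fun q => ⟨⟨q.1, q.2.1⟩, fun hmem =>
          q.2.2 (congrArg Subtype.val (Finset.mem_singleton.1 hmem))⟩
      left_inv := fun y => rfl
      right_inv := fun q => rfl }
  have heq : ∑' q : {q : E3 // q ∈ P.points ∧ q ≠ p₀}, f (dist w q.1) =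
      ∑' y : {y : P.points // y ∉ ({⟨p₀, hp₀⟩} : Finset P.points)}, f (dist w ((y.1 : P.points) : E3)) := by
    rw [← e.tsum_eq]
    exact tsum_congr fun y => rfl
  rw [heq]
  exact hsplit

/-- **Invisibility at the site**: `Σ'_{y ∈ P, y ≠ p₀} f(dist p₀ y) = −f 0` (every site of the witness
crystal is individually `f`-neutral, `Field.siteSum_eq_neg_f_zero_of_isSplit`). [folklore] -/
theorem tsum_f_site_eq_neg_f_zero {P : PeriodicConfiguration 3} {ρ c : ℝ} {g U f : ℝ → ℝ}
    (h : IsSplit ρ c g U f) (hv : c + f 0 / 2 ≤ -(P.energyPerParticle lennardJones))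
    {p₀ : E3} (hp₀ : p₀ ∈ P.points) :
    ∑' q : {q : E3 // q ∈ P.points ∧ q ≠ p₀}, f (dist p₀ q.1) = -f 0 :=
  siteSum_eq_neg_f_zero_of_isSplit h hv hp₀

/-! ## Termwise comparison with the remainder `V − g` -/

/-- At a positive distance, `f ≤ V − g` (the slack `U` is non-negative). [folklore] -/
theorem f_le_lennardJones_sub_g {ρ c : ℝ} {g U f : ℝ → ℝ} (h : IsSplit ρ c g U f) {r : ℝ}
    (hr : 0 < r) : f r ≤ lennardJones r - g r := by
  have h1 := h.split r hr
  have h2 := h.U_nonneg r hr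
  linarith

/-- At the distances of the witness crystal, `f = V − g` exactly (`U = 0` on `D_P`). [folklore] -/
theorem f_site_eq {P : PeriodicConfiguration 3} {ρ c : ℝ} {g U f : ℝ → ℝ}
    (h : IsSplit ρ c g U f) (hv : c + f 0 / 2 ≤ -(P.energyPerParticle lennardJones))
    {p₀ : E3} (hp₀ : p₀ ∈ P.points) (q : {q : E3 // q ∈ P.points ∧ q ≠ p₀}) :
    f (dist p₀ q.1) = lennardJones (dist p₀ q.1) - g (dist p₀ q.1) := by
  have hd : 0 < dist p₀ q.1 := dist_pos.2 fun heq => q.2.2 heq.symm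
  have h1 := h.split _ hd
  have h2 := U_site_eq_zero h hv hp₀ q
  linarith

/-! ## Einstein domination -/

/-- **Lower bound at the probe**: `−Σ'_{y ≠ p₀} (V − g)(dist w y) ≤ f(dist w p₀)`. [folklore] -/
theorem neg_tsum_cavity_le_f_dist {P : PeriodicConfiguration 3} {ρ c : ℝ} {g U f : ℝ → ℝ}
    (h : IsSplit ρ c g U f) (hv : c + f 0 / 2 ≤ -(P.energyPerParticle lennardJones))
    {p₀ w : E3} (hp₀ : p₀ ∈ P.points) (hw : w ∉ P.points) :
    -(∑' q : {q : E3 // q ∈ P.points ∧ q ≠ p₀}, (lennardJones (dist w q.1) - g (dist w q.1))) ≤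
      f (dist w p₀) := by
  obtain ⟨hsum, hzero⟩ := f_dist_probe_add_tsum_eq_zero h hv hp₀ (w := w)
  have hle : ∑' q : {q : E3 // q ∈ P.points ∧ q ≠ p₀}, f (dist w q.1) ≤
      ∑' q : {q : E3 // q ∈ P.points ∧ q ≠ p₀}, (lennardJones (dist w q.1) - g (dist w q.1)) :=
    hsum.tsum_le_tsum (fun q => f_le_lennardJones_sub_g h
      (dist_pos.2 fun heq => hw (heq ▸ q.2.1))) (summable_cavity_probe P h hw)
  linarith

/-- **The value at the origin is the cavity energy of the site**:
`f 0 = −Σ'_{y ≠ p₀} (V − g)(dist p₀ y)`. [folklore] -/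
theorem f_zero_eq_neg_tsum_cavity {P : PeriodicConfiguration 3} {ρ c : ℝ} {g U f : ℝ → ℝ}
    (h : IsSplit ρ c g U f) (hv : c + f 0 / 2 ≤ -(P.energyPerParticle lennardJones))
    {p₀ : E3} (hp₀ : p₀ ∈ P.points) :
    f 0 = -(∑' q : {q : E3 // q ∈ P.points ∧ q ≠ p₀},
      (lennardJones (dist p₀ q.1) - g (dist p₀ q.1))) := by
  rw [← tsum_congr fun q => f_site_eq h hv hp₀ q, tsum_f_site_eq_neg_f_zero h hv hp₀, neg_neg]

/-- **EINSTEIN DOMINATION.**  For a witness `⟨P, ρ, c, g, U, f⟩` (any three-cone split attaining the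
periodic configuration `P`), a site `p₀ ∈ P` and a probe `w ∉ P`:
`f 0 − f(dist w p₀) ≤ Σ'_{y ∈ P, y ≠ p₀} [(V − g)(dist w y) − (V − g)(dist p₀ y)]` — the cavity
excess of the remainder `V − g` under the single-particle move `p₀ ↦ w`. [folklore] -/
theorem f_zero_sub_f_le_cavity {P : PeriodicConfiguration 3} {ρ c : ℝ} {g U f : ℝ → ℝ}
    (h : IsSplit ρ c g U f) (hv : c + f 0 / 2 ≤ -(P.energyPerParticle lennardJones))
    {p₀ w : E3} (hp₀ : p₀ ∈ P.points) (hw : w ∉ P.points) :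
    f 0 - f (dist w p₀) ≤ ∑' q : {q : E3 // q ∈ P.points ∧ q ≠ p₀},
      ((lennardJones (dist w q.1) - g (dist w q.1)) -
        (lennardJones (dist p₀ q.1) - g (dist p₀ q.1))) := by
  rw [(summable_cavity_probe P h hw).tsum_sub (summable_cavity_site P h p₀),
    f_zero_eq_neg_tsum_cavity h hv hp₀]
  have := neg_tsum_cavity_le_f_dist h hv hp₀ hw
  linarith

/-- **EINSTEIN DOMINATION, split form**: the same bound as "pure Lennard-Jones cavity excess minus the
`g`-cavity excess", each of the four site families being summable. [folklore] -/
theorem f_zero_sub_f_le_cavity_split {P : PeriodicConfiguration 3} {ρ c : ℝ} {g U f : ℝ → ℝ}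
    (h : IsSplit ρ c g U f) (hv : c + f 0 / 2 ≤ -(P.energyPerParticle lennardJones))
    {p₀ w : E3} (hp₀ : p₀ ∈ P.points) (hw : w ∉ P.points) :
    f 0 - f (dist w p₀) ≤
      (∑' q : {q : E3 // q ∈ P.points ∧ q ≠ p₀}, (lennardJones (dist w q.1) - lennardJones (dist p₀ q.1)))
      - ∑' q : {q : E3 // q ∈ P.points ∧ q ≠ p₀}, (g (dist w q.1) - g (dist p₀ q.1)) := by
  have hV := (summable_lennardJones_probe P (p₀ := p₀) hw).sub (P.summable_lennardJones_dist_three p₀)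
  have hg := (summable_finRange_probe P h.g_zero (p₀ := p₀) hw).sub (summable_of_finRange P h.g_zero p₀)
  rw [← hV.tsum_sub hg]
  refine (f_zero_sub_f_le_cavity h hv hp₀ hw).trans_eq (tsum_congr fun q => by ring)

/-- **Registered-style restatement `einstein_of_clauses`** (crux conjuncts 2–7 verbatim as hypotheses):
Einstein domination holds for every witness of `StrictCertificate` (indeed of `ExactCertificate`).
[folklore] -/
theorem einstein_of_clauses : ∀ (P : Literature.MathematicalPhysics.StatisticalMechanics.PeriodicConfiguration 3) (ρ c : ℝ) (g U f : ℝ → ℝ), (∀ r : ℝ, 0 < r → Literature.MathematicalPhysics.StatisticalMechanics.lennardJones r = g r + U r + f r) → (∀ r : ℝ, 0 < r → 0 ≤ U r) → (∀ r : ℝ, ρ ≤ r → g r = 0) → (∀ (n : ℕ) (y : Fin n → EuclideanSpace ℝ (Fin 3)) (w : Fin n → ℝ), 0 ≤ ∑ i, ∑ j, w i * w j * f (dist (y i) (y j))) → (∀ (N : ℕ) (x : Fin N → EuclideanSpace ℝ (Fin 3)), Function.Injective x → -(c * (N : ℝ)) ≤ Literature.MathematicalPhysics.StatisticalMechanics.interactionEnergy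 g x) → c + f 0 / 2 = -(P.energyPerParticle Literature.MathematicalPhysics.StatisticalMechanics.lennardJones) → ∀ p₀ ∈ P.points, ∀ w ∉ P.points, f 0 - f (dist w p₀) ≤ ∑' q : {q : EuclideanSpace ℝ (Fin 3) // q ∈ P.points ∧ q ≠ p₀}, ((Literature.MathematicalPhysics.StatisticalMechanics.lennardJones (dist w q.1) - g (dist w q.1)) - (Literature.MathematicalPhysics.StatisticalMechanics.lennardJones (dist p₀ q.1) - g (dist p₀ q.1))) :=
  fun _P _ρ _c _g _U _f h1 h2 h3 h4 h5 h6 _p₀ hp₀ _w hw =>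
    f_zero_sub_f_le_cavity ⟨h1, h2, h3, h4, h5⟩ h6.le hp₀ hw

end Summit.AtomisticToContinuum.Crystallization.Theorems.BraggSlacknessRigidityStrictCertificate

end
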